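import Summits.AtomisticToContinuum.Crystallization.Theorems.SlackRigidity.Negative.WitnessBasics
import Literature.MathematicalPhysics.StatisticalMechanics.LennardJonesClusters
import HarnessLib

/-!
# Crux `SlackRigidity` (stmt-AtomisticToContinuum-11960), line `ekeland-surgery-parity`:
# stub E1 `stub_hammingEkeland` — the discrete Ekeland principle in the Hamming metric

Route `ThreeConeCertificate`, sub-problem `Crystallization`.  On labelled `N`-point configurations
`x : Fin N → ℝ³` put the integer-valued Hamming metric `d_H(y, x) = #{i : y i ≠ x i}`.  For every
`λ > 0` and every injective `x` we produce an injective `λ`-quasi-ground-state `x'` (no injective `y`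
has `𝓔(y) < 𝓔(x') − λ · d_H(y, x')`) with `𝓔(x') ≤ 𝓔(x)` and `λ · d_H(x', x) ≤ 𝓔(x) − 𝓔(x')`,
where `𝓔` is the Lennard-Jones interaction energy.

Proof: strong induction on a natural number `n` with `𝓔(x) − E(N) < (n + 1) · λ` (such an `n` exists
by the Archimedean property; `E(N) ≤ 𝓔` on injective configurations is the tree lemma
`groundStateEnergy_lennardJones_le`).  If `x` is already a quasi-ground-state take `x' = x`.
Otherwise some injective `y ≠ x` has `𝓔(y) < 𝓔(x) − λ · d_H(y, x) ≤ 𝓔(x) − λ`, so `n ≥ 1` and the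
induction hypothesis applies to `y` with `n − 1`; the resulting `x'` works for `x` by the Hamming
triangle inequality `d_H(x', x) ≤ d_H(x', y) + d_H(y, x)`.  Pure finite combinatorics and linear
arithmetic; no minimisers, no analysis.
-/

noncomputable section

namespace Summit.AtomisticToContinuum.Crystallization.Theorems.EkelandHammingEkeland

open scoped BigOperators
open Literature.MathematicalPhysics.StatisticalMechanics
open Summit.AtomisticToContinuum.Crystallization.Theorems.SlackRigidityNegative (E3)

/-- **Hamming triangle inequality** for labelled configurations:
`#{i : a i ≠ c i} ≤ #{i : a i ≠ b i} + #{i : b i ≠ c i}` (cast to `ℝ`). [folklore] -/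
theorem hammingCard_triangle {N : ℕ} (a b c : Fin N → E3) :
    ((Finset.univ.filter fun i => a i ≠ c i).card : ℝ) ≤
      ((Finset.univ.filter fun i => a i ≠ b i).card : ℝ) +
        ((Finset.univ.filter fun i => b i ≠ c i).card : ℝ) := by
  have hsub : (Finset.univ.filter fun i => a i ≠ c i) ⊆
      (Finset.univ.filter fun i => a i ≠ b i) ∪ (Finset.univ.filter fun i => b i ≠ c i) := by
    intro i hi
    simp only [Finset.mem_filter, Finset.mem_union, Finset.mem_univ, true_and] at hi ⊢
    by_contra h
    push Not at h
    exact hi (h.1.trans h.2)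
  exact_mod_cast (Finset.card_le_card hsub).trans (Finset.card_union_le _ _)

/-- **A configuration at Hamming distance `0` is the same configuration**: if
`#{i : y i ≠ x i} < 1` (as reals) then `y = x`. [folklore] -/
theorem hammingCard_eq_of_lt_one {N : ℕ} {y x : Fin N → E3}
    (h : ((Finset.univ.filter fun i => y i ≠ x i).card : ℝ) < 1) : y = x := by
  funext i
  by_contra hne
  have hi : i ∈ Finset.univ.filter fun i => y i ≠ x i := by simp [hne]
  have hpos : 1 ≤ (Finset.univ.filter fun i => y i ≠ x i).card := Finset.card_pos.mpr ⟨i, hi⟩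
  have : (1 : ℝ) ≤ ((Finset.univ.filter fun i => y i ≠ x i).card : ℝ) := by exact_mod_cast hpos
  linarith

/-- **Hamming–Ekeland principle, bounded-height form.** For `λ > 0` and every `n : ℕ`: every injective
configuration `x` with `𝓔(x) − E(N) < (n + 1) · λ` admits an injective `λ`-quasi-ground-state `x'`
with `𝓔(x') ≤ 𝓔(x)` and `λ · d_H(x', x) ≤ 𝓔(x) − 𝓔(x')`.  Strong induction on `n`. [folklore] -/
theorem hammingEkeland_of_lt {N : ℕ} {lam : ℝ} (hlam : 0 < lam) (n : ℕ) :
    ∀ x : Fin N → E3, Function.Injective x →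
      interactionEnergy lennardJones x - groundStateEnergy lennardJones 3 N < (n + 1) * lam →
      ∃ x' : Fin N → E3, Function.Injective x' ∧
        (∀ y : Fin N → E3, Function.Injective y →
          interactionEnergy lennardJones x' -
              lam * ((Finset.univ.filter fun i => y i ≠ x' i).card : ℝ) ≤
            interactionEnergy lennardJones y) ∧
        interactionEnergy lennardJones x' ≤ interactionEnergy lennardJones x ∧
        lam * ((Finset.univ.filter fun i => x' i ≠ x i).card : ℝ) ≤
          interactionEnergy lennardJones x - interactionEnergy lennardJones x' := by
  induction n using Nat.strong_induction_on with
  | _ n ih =>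
    intro x hx hn
    by_cases hq : ∀ y : Fin N → E3, Function.Injective y →
        interactionEnergy lennardJones x -
            lam * ((Finset.univ.filter fun i => y i ≠ x i).card : ℝ) ≤
          interactionEnergy lennardJones y
    · -- `x` is already a quasi-ground-state: take `x' = x`
      refine ⟨x, hx, hq, le_rfl, ?_⟩
      simp
    · -- an improving competitor `y` at Hamming distance `d ≥ 1`
      push Not at hq
      obtain ⟨y, hy, hlt⟩ := hq
      have hEy : groundStateEnergy lennardJones 3 N ≤ interactionEnergy lennardJones y :=
        groundStateEnergy_lennardJones_le (d := 3) hy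
      have hd : (1 : ℝ) ≤ ((Finset.univ.filter fun i => y i ≠ x i).card : ℝ) := by
        by_contra h
        push Not at h
        have hyx : y = x := hammingCard_eq_of_lt_one h
        subst hyx
        simp at hlt
      have hlamd : lam ≤ lam * ((Finset.univ.filter fun i => y i ≠ x i).card : ℝ) :=
        le_mul_of_one_le_right hlam.le hd
      -- hence `n ≥ 1`, and the induction hypothesis applies to `y` at height `n - 1`
      have hn0 : n ≠ 0 := by
        rintro rfl
        push_cast at hn
        linarith
      obtain ⟨m, rfl⟩ := Nat.exists_eq_succ_of_ne_zero hn0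
      obtain ⟨x', hx', hq', hE', hH'⟩ :=
        ih m (Nat.lt_succ_self m) y hy (by push_cast at hn ⊢; linarith)
      refine ⟨x', hx', hq', by linarith, ?_⟩
      -- chain the Hamming triangle inequality
      have htri := mul_le_mul_of_nonneg_left (hammingCard_triangle x' y x) hlam.le
      rw [mul_add] at htri
      linarith

/-- **Stub E1 — Hamming–Ekeland principle (discrete Ekeland in the integer-valued Hamming
metric).** For `λ > 0`, every injective configuration `x` can be replaced by a `λ`-quasi-ground-state
`x'` (no relocation of `k` particles lowers the energy by more than `k·λ`) with
`𝓔(x') ≤ 𝓔(x)` and `λ · #{i : x' i ≠ x i} ≤ 𝓔(x) − 𝓔(x')`.  From `hammingEkeland_of_lt` with a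
height `n > (𝓔(x) − E(N))/λ` supplied by the Archimedean property.  No existence of minimisers
needed. [folklore] -/
theorem stub_hammingEkeland :
    ∀ (N : ℕ) (lam : ℝ), 0 < lam → ∀ x : Fin N → E3, Function.Injective x →
      ∃ x' : Fin N → E3, Function.Injective x' ∧
        (∀ y : Fin N → E3, Function.Injective y →
          interactionEnergy lennardJones x' -
              lam * ((Finset.univ.filter fun i => y i ≠ x' i).card : ℝ) ≤
            interactionEnergy lennardJones y) ∧
        interactionEnergy lennardJones x' ≤ interactionEnergy lennardJones x ∧
        lam * ((Finset.univ.filter fun i => x' i ≠ x i).card : ℝ) ≤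
          interactionEnergy lennardJones x - interactionEnergy lennardJones x' := by
  intro N lam hlam x hx
  obtain ⟨n, hn⟩ := exists_nat_gt
    ((interactionEnergy lennardJones x - groundStateEnergy lennardJones 3 N) / lam)
  refine hammingEkeland_of_lt hlam n x hx ?_
  rw [div_lt_iff₀ hlam] at hn
  nlinarith

end Summit.AtomisticToContinuum.Crystallization.Theorems.EkelandHammingEkeland

end
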